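import Summits.QuantumFields.YangMills.Theorems.BalabanUVNodesN19ExpectationCurrencyTwoConstantsAtScheme
import Summits.QuantumFields.YangMills.Theorems.BalabanUVNodesN19CoreMetric
import Summits.QuantumFields.BalabanUV.T4Continuum.Spine.NE1p.DressedMGFForm

/-!
# BalabanUVNodes ∕ N19 (NE7 proper) — THE CONVERSE OF THE JOIN: for MGF-form cores, `NE7.Core` FORCES the vacuum core (V) AND
# N14's `TiltedMeanMatching` (I) on every inner tilt window, at the linear-log price — road (ii)'s two displayed inputs are
# NECESSARY as well as sufficient

Cell `pub-ymgap` (HUMAN RULING D-0062, Track A), R141 (C) WIDER STRATEGY seat `pub-ymgap-dag-n19-e` (strategy s3 «alternative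
currency», option «converse-of-join» of the seat brief), gen 8.  Filed `--kind proof --supports` K3‴ `SpineGivenEndpointR13` =
stmt-QuantumFields-19912 `--as helper` (route rev 17).  COUNT-NEUTRAL.  THEOREMS ONLY (0 `def`); imports this seat's expectation-currency
modules (p477102 Landau ∕ p480837 two constants ∕ p481156 summability, through `…ExpectationCurrencyTwoConstantsAtScheme`), this seat's
`…N19CoreMetric` (p462782: `abs_log_sub_log_sub_le_of_sandwich`) and gaps-ne1's `Spine/NE1p/DressedMGFForm` (`tiltedMean`,
`TiltedMeanMatching`, `MGFForm`, `core_of_mgfForm`); edits nothing.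

THE JOIN (lens decomp v4 ROW VL-1, dag-n19-d `…N19VacuumMGFRoad.core_of_coreZero_mgfForm`, over gaps-ne1 `DressedMGFForm.core_of_mgfForm`):
for two families of shell-free cores in MGF form (`P K t τ = mgf (F K) (ν K τ) t`, `Q K t τ = mgf (F′ K) (ν′ K τ) t`, `|F|, |F′| ≤ B`)
«vacuum core (V) `NE7.Core … (P at t = 0) (Q at t = 0) δ⁰` + N14's binder (I) `TiltedMeanMatching l₀ T Bad F ν F′ ν′ η` ⇒ dressed
`NE7.Core l₀ vol T Bad P Q (δ⁰ + (l₀∕vol)·η)`».  THIS FILE PROVES THE CONVERSE: the dressed `NE7.Core l₀ vol T Bad P Q δ` forces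
* (V) — its `t = 0` face (`coreZero_of_core`), and
* (I) on EVERY INNER WINDOW `l₁ < l₀`: `TiltedMeanMatching l₁ T Bad F ν F′ ν′ η` with
  `η K = 8·e^{1+(l₀−l₁)B}·volδ_K·(1 + log⁺(2volδ_K)⁻¹)∕(l₀ − l₁)` (`tiltedMeanMatching_of_core`, ★) — or, by the real-variable road,
  `η K = 4volδ_K∕(l₀ − l₁) + 2B·√(volδ_K)` (`tiltedMeanMatching_of_core_sqrt`; no exponential in `B`, worse in `δ`);
  `Σ_K volδ_K(1 + log⁺(volδ_K)⁻¹) < ∞` (in particular geometric `δ`) keeps `η` summable (`tiltedMeanMatching_summable_of_core(_geometric)`);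
* hence (`coreZero_tiltedMeanMatching_of_coreEdge`, ★★) the EXACT HYPOTHESIS LIST of the join's ∃δ-form `coreEdge_of_coreZero_mgfForm`
  (vacuum core with summable `δ⁰`, binder with summable `η`) is RECOVERED on the inner window from `NE7.Core … δ` once `Σ volδ_K(1+log⁺(volδ_K)⁻¹) < ∞`
  (slightly MORE than the join's output `Summable δ` — the one logarithm lost).
So, for ONE bounded observable, road (ii)'s displayed pair (V)+(I) is a COMPLETE set of invariants of NE7-proper up to (window shrink, one
logarithm): N19-proper is NOT EASIER than N14's binder — any producer of `NE7.Core` for MGF-form cores (the H1L face `NE7.PathLeaf`: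
`tiltedMeanMatching_of_pathLeaf`; `HybridNE7`'s core field: `tiltedMeanMatching_of_hybridNE7`) produces `TiltedMeanMatching` on the inner window.
(Lens decomp v6, prose only: road (iii)'s measure-level MASS_cl × SHAPE_cl is SUFFICIENT and observable-uniform; `Core` for one observable `W`
constrains only the `W`-marginals, so it does not return SHAPE_cl — nothing is claimed there.)

KEY STEP [folklore, §1].  The tilted mean at tilt `s` is the UNTILTED mean under the probability measure `ν_s = ν.tilted (s·F)`, and the
cumulant generating function of `F` under `ν_s` is the SHIFTED one, `t ↦ cgf F ν (s+t) − cgf F ν s` (`mgf_tilted_mul`, `cgf_tilted_mul`): the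
`t`-independent constant `c_K` of `Core` CANCELS in the difference of the two runs' shifted cgf's, which are therefore `2volδ_K`-close on
`|t| < l₀ − |s|`; then this seat's `abs_integral_sub_integral_le_linlog_of_cgf_close` (two constants + Cauchy, p480837) resp.
`abs_sub_deriv_cgf_zero_le` (Landau, p477102) on the window `l₀ − l₁`.  Massless classes are matched by `Core` itself (§2).

CONTENTS.  §1 tilting [folklore]: `mgf_tilted_mul` · `cgf_tilted_mul` · `isProbabilityMeasure_tilted_mul` · `tiltedMean_zero_measure`.
§2 one class: `abs_tiltedMean_sub_le_linlog_of_cgf_close` · `abs_tiltedMean_sub_le_sqrt_of_cgf_close` · `neZero_or_eq_zero_of_sandwich` ·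
`abs_tiltedMean_sub_le_linlog_of_sandwich` · `abs_tiltedMean_sub_le_sqrt_of_sandwich` · `tiltedMean_eq_of_mgf_eq_mul` (ε = 0 face: exact matching
mod constants on a window ⇒ identical tilted means inside).  §3 at the leaf: `coreZero_of_core` · ★ `tiltedMeanMatching_of_core` ·
`tiltedMeanMatching_of_core_sqrt` · `posLog_inv_two_mul_le` · `tiltedMeanMatching_summable_of_core` · `tiltedMeanMatching_summable_of_core_geometric` ·
★★ `coreZero_tiltedMeanMatching_of_coreEdge` · `tiltedMeanMatching_of_pathLeaf` · `tiltedMeanMatching_of_hybridNE7`.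
HYPOTHESIS ON BAD CLASSES (displayed): t-UNIFORM goodness on the window — `Bad K u ⊆ Bad K t` for `|t| ≤ l₁`, `|u| ≤ l₀` (a class good at an
inner source is good on the whole window; t-constant bad families qualify): `Core` is used at every source `u` of the window for the class at hand.

HONEST FRAMING.  [folklore] complex ∕ real analysis (two constants + Cauchy; Landau) and Mathlib `Measure.tilted` ∕ `mgf` ∕ `cgf` bookkeeping on
hypothesis SHAPES (`MGFForm`, `NE7.Core`, `TiltedMeanMatching` are parametric propositions); a NECESSITY result — it discharges nothing;
NOTHING of Bałaban's is instantiated; NE7 ∕ NE1′ ∕ `TiltedMeanMatching` NOT PRINTED as two-run statements for d = 4 and NOT proved; N19 NOT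
discharged (0∕1); K3‴ NOT claimed; counts UNMOVED (5∕27).  One finite T⁴ programme at fixed `ε` — NOT ℝ⁴ ∕ OS ∕ mass gap ∕ Clay.  0 `def` ∕ `sorry`.
-/

noncomputable section

open MeasureTheory ProbabilityTheory Finset Set

namespace Summit.QuantumFields.YangMills.BalabanUVNodes.N19MGFJoinConverse

open Literature.MathematicalPhysics.QuantumFieldTheory.Balaban1983to89
open Summit.QuantumFields.BalabanUV.T4Continuum.Spine
open Summit.QuantumFields.BalabanUV.T4Continuum.NE1p.DressedMGFForm (tiltedMean deriv_cgf_eq_tiltedMean MGFForm TiltedMeanMatching)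
open Summit.QuantumFields.YangMills.BalabanUVNodes.N19ExpectationCurrency (abs_sub_deriv_cgf_zero_le)
open Summit.QuantumFields.YangMills.BalabanUVNodes.N19ExpectationCurrencyTwoConstants (abs_integral_sub_integral_le_linlog_of_cgf_close)
open Summit.QuantumFields.YangMills.BalabanUVNodes.N19ExpectationCurrencyTwoConstantsAtScheme (summable_linlog_of_le_geometric)
open Summit.QuantumFields.YangMills.BalabanUVNodes.N19CoreMetric (abs_log_sub_log_sub_le_of_sandwich)

/-! ## §1 Tilting: the moment ∕ cumulant generating function under the source-tilted measure is the shifted one [folklore] -/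

section Tilting

variable {Ω : Type*} {mΩ : MeasurableSpace Ω} {ν : Measure Ω} {F : Ω → ℝ} {B : ℝ}

/-- **MGF UNDER THE TILTED MEASURE** [folklore]: `mgf F (ν.tilted (s·F)) t = mgf F ν (s + t) ∕ mgf F ν s` (Mathlib `integral_tilted`;
both sides `0` in the junk cases). -/
theorem mgf_tilted_mul (F : Ω → ℝ) (ν : Measure Ω) (s t : ℝ) :
    mgf F (ν.tilted fun ω => s * F ω) t = mgf F ν (s + t) / mgf F ν s := by
  simp only [mgf, integral_tilted, smul_eq_mul]
  rw [← integral_div]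
  refine integral_congr_ae (ae_of_all _ fun ω => ?_)
  simp only [add_mul, Real.exp_add]
  ring

variable [IsFiniteMeasure ν]

/-- **CGF UNDER THE TILTED MEASURE IS THE SHIFTED CGF** [folklore]: for `ν ≠ 0` finite and `F` measurable with `|F| ≤ B` (so every `mgf F ν u > 0`),
`cgf F (ν.tilted (s·F)) t = cgf F ν (s + t) − cgf F ν s`.  An additive constant in a comparison of two cgf's CANCELS here. -/
theorem cgf_tilted_mul [NeZero ν] (hFm : Measurable F) (hF : ∀ ω, |F ω| ≤ B) (s t : ℝ) :
    cgf F (ν.tilted fun ω => s * F ω) t = cgf F ν (s + t) - cgf F ν s := by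
  have hpos : ∀ u, 0 < mgf F ν u := fun u => T4GenFunBounds.mgf_pos_of_abs_le hFm.aemeasurable (ae_of_all _ hF) u
  simp only [cgf]
  rw [mgf_tilted_mul, Real.log_div (hpos _).ne' (hpos _).ne']

/-- The source-tilted measure (non-zero finite measure, bounded measurable observable) is a probability measure. [folklore] -/
theorem isProbabilityMeasure_tilted_mul [NeZero ν] (hFm : Measurable F) (hF : ∀ ω, |F ω| ≤ B) (s : ℝ) :
    IsProbabilityMeasure (ν.tilted fun ω => s * F ω) :=
  isProbabilityMeasure_tilted (T4GenFunBounds.integrable_exp_mul_of_bound hFm.aemeasurable (ae_of_all _ hF) s)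

omit [IsFiniteMeasure ν] in
/-- The tilted mean under the zero measure is `0` (junk value matched). [folklore] -/
theorem tiltedMean_zero_measure (F : Ω → ℝ) (s : ℝ) : tiltedMean F (0 : Measure Ω) s = 0 := by
  simp [tiltedMean]

end Tilting

/-! ## §2 One class, two runs: mod-constants closeness of the cgf's on a window pays the tilted means inside the window -/

section OneClass

variable {Ω Ω' : Type*} {mΩ : MeasurableSpace Ω} {mΩ' : MeasurableSpace Ω'} {ν : Measure Ω} {ν' : Measure Ω'}
  [IsFiniteMeasure ν] [IsFiniteMeasure ν'] {F : Ω → ℝ} {F' : Ω' → ℝ} {B : ℝ}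

/-- **CLOSE CGF's MOD A CONSTANT ON A WINDOW ⇒ CLOSE TILTED MEANS INSIDE, AT THE LINEAR-LOG PRICE** [folklore].  `ν`, `ν′` non-zero finite,
`F`, `F′` measurable with `|F|, |F′| ≤ B`; if `|cgf F′ ν′ u − cgf F ν u − c| ≤ ε` for `|u| ≤ l₀` (ONE constant `c`, `0 ≤ ε`), then for every
tilt `|s| ≤ l₁ < l₀`: `|tiltedMean F′ ν′ s − tiltedMean F ν s| ≤ 8e^{1+(l₀−l₁)B}·ε·(1 + log⁺(2ε)⁻¹)∕(l₀ − l₁)` — the two constants road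
(`abs_integral_sub_integral_le_linlog_of_cgf_close` BY NAME) for the tilted probability measures, whose cgf's are the shifted ones (§1). -/
theorem abs_tiltedMean_sub_le_linlog_of_cgf_close [NeZero ν] [NeZero ν'] (hFm : Measurable F) (hF : ∀ ω, |F ω| ≤ B)
    (hFm' : Measurable F') (hF' : ∀ ω, |F' ω| ≤ B) {c ε l₀ l₁ : ℝ} (hl : l₁ < l₀) (hε0 : 0 ≤ ε)
    (hε : ∀ u : ℝ, |u| ≤ l₀ → |cgf F' ν' u - cgf F ν u - c| ≤ ε) {s : ℝ} (hs : |s| ≤ l₁) :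
    |tiltedMean F' ν' s - tiltedMean F ν s| ≤
      8 * Real.exp (1 + (l₀ - l₁) * B) * ε * (1 + Real.posLog (2 * ε)⁻¹) / (l₀ - l₁) := by
  haveI := isProbabilityMeasure_tilted_mul (ν := ν) hFm hF s
  haveI := isProbabilityMeasure_tilted_mul (ν := ν') hFm' hF' s
  have hclose : ∀ t : ℝ, |t| < l₀ - l₁ →
      |cgf F' (ν'.tilted fun ω => s * F' ω) t - cgf F (ν.tilted fun ω => s * F ω) t| ≤ 2 * ε := by
    intro t ht
    rw [cgf_tilted_mul hFm' hF', cgf_tilted_mul hFm hF]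
    have h1 := hε (s + t) ((abs_add_le s t).trans (by linarith [ht.le]))
    have h2 := hε s (hs.trans hl.le)
    have e : cgf F' ν' (s + t) - cgf F' ν' s - (cgf F ν (s + t) - cgf F ν s)
        = (cgf F' ν' (s + t) - cgf F ν (s + t) - c) - (cgf F' ν' s - cgf F ν s - c) := by ring
    rw [e]
    exact (abs_sub _ _).trans (by linarith)
  have key := abs_integral_sub_integral_le_linlog_of_cgf_close (μ := ν.tilted fun ω => s * F ω) (ν := ν'.tilted fun ω => s * F' ω)
    (X := F) (Y := F') hFm.aemeasurable hFm'.aemeasurable (ae_of_all _ hF) (ae_of_all _ hF') (sub_pos.mpr hl) (by positivity) hclose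
  calc |tiltedMean F' ν' s - tiltedMean F ν s|
      = |∫ ω, F' ω ∂(ν'.tilted fun ω => s * F' ω) - ∫ ω, F ω ∂(ν.tilted fun ω => s * F ω)| := rfl
    _ ≤ 4 * Real.exp (1 + (l₀ - l₁) * B) * (2 * ε) * (1 + Real.posLog (2 * ε)⁻¹) / (l₀ - l₁) := key
    _ = 8 * Real.exp (1 + (l₀ - l₁) * B) * ε * (1 + Real.posLog (2 * ε)⁻¹) / (l₀ - l₁) := by ring

/-- **THE REAL-VARIABLE ROAD (price √)** [folklore].  Same hypotheses; for `|s| ≤ l₁ < l₀`: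
`|tiltedMean F′ ν′ s − tiltedMean F ν s| ≤ 4ε∕(l₀ − l₁) + 2B·√ε` — Landau's inequality at the centre of the window `[s − (l₀−l₁), s + (l₀−l₁)]`
(`abs_sub_deriv_cgf_zero_le` BY NAME: the second derivatives of the shifted cgf's are tilted variances in `[0, B²]`) for the tilted probability
measures; no exponential in `B`, no logarithm, but `√ε` instead of `ε·log ε⁻¹`. -/
theorem abs_tiltedMean_sub_le_sqrt_of_cgf_close [NeZero ν] [NeZero ν'] (hFm : Measurable F) (hF : ∀ ω, |F ω| ≤ B)
    (hFm' : Measurable F') (hF' : ∀ ω, |F' ω| ≤ B) {c ε l₀ l₁ : ℝ} (hl : l₁ < l₀)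
    (hε : ∀ u : ℝ, |u| ≤ l₀ → |cgf F' ν' u - cgf F ν u - c| ≤ ε) {s : ℝ} (hs : |s| ≤ l₁) :
    |tiltedMean F' ν' s - tiltedMean F ν s| ≤ 4 * ε / (l₀ - l₁) + 2 * B * Real.sqrt ε := by
  haveI := isProbabilityMeasure_tilted_mul (ν := ν) hFm hF s
  haveI := isProbabilityMeasure_tilted_mul (ν := ν') hFm' hF' s
  have hB : 0 ≤ B := T4GenFunBounds.nonneg_of_ae_abs_le (NeZero.ne ν) (ae_of_all _ hF)
  have hclose : ∀ t ∈ Icc (-(l₀ - l₁)) (l₀ - l₁),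
      |(cgf F' (ν'.tilted fun ω => s * F' ω) t - cgf F' (ν'.tilted fun ω => s * F' ω) 0) -
        (cgf F (ν.tilted fun ω => s * F ω) t - cgf F (ν.tilted fun ω => s * F ω) 0)| ≤ 2 * ε := by
    intro t ht
    have ht' : |t| ≤ l₀ - l₁ := abs_le.mpr ⟨ht.1, ht.2⟩
    rw [cgf_tilted_mul hFm' hF', cgf_tilted_mul hFm' hF', cgf_tilted_mul hFm hF, cgf_tilted_mul hFm hF]
    have h1 := hε (s + t) ((abs_add_le s t).trans (by linarith))
    have h2 := hε s (hs.trans hl.le)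
    have e : cgf F' ν' (s + t) - cgf F' ν' s - (cgf F' ν' (s + 0) - cgf F' ν' s) -
          (cgf F ν (s + t) - cgf F ν s - (cgf F ν (s + 0) - cgf F ν s))
        = (cgf F' ν' (s + t) - cgf F ν (s + t) - c) - (cgf F' ν' s - cgf F ν s - c) := by
      simp only [add_zero]; ring
    rw [e]
    exact (abs_sub _ _).trans (by linarith)
  have key := abs_sub_deriv_cgf_zero_le (μ := ν.tilted fun ω => s * F ω) (ν := ν'.tilted fun ω => s * F' ω)
    (X := F) (Y := F') hFm.aemeasurable (ae_of_all _ hF) hFm'.aemeasurable (ae_of_all _ hF') (sub_pos.mpr hl) hclose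
  rw [deriv_cgf_eq_tiltedMean hFm' hF' 0, deriv_cgf_eq_tiltedMean hFm hF 0] at key
  have e1 : tiltedMean F (ν.tilted fun ω => s * F ω) 0 = tiltedMean F ν s := by simp only [tiltedMean, zero_mul, tilted_const]
  have e2 : tiltedMean F' (ν'.tilted fun ω => s * F' ω) 0 = tiltedMean F' ν' s := by simp only [tiltedMean, zero_mul, tilted_const]
  rw [e1, e2] at key
  refine key.trans (le_of_eq ?_)
  have hε0 : 0 ≤ ε := (abs_nonneg _).trans (hε s (hs.trans hl.le))
  have hsq : Real.sqrt (2 * (2 * ε) * B ^ 2) = 2 * B * Real.sqrt ε := by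
    rw [show 2 * (2 * ε) * B ^ 2 = (2 * B) ^ 2 * ε by ring, Real.sqrt_mul (sq_nonneg _), Real.sqrt_sq (by positivity)]
  rw [hsq]
  ring

/-- **MASSLESS OR MASSIVE TOGETHER** [folklore].  Under the MGF sandwich `e^{c−ε}·mgf F ν u ≤ mgf F′ ν′ u ≤ e^{c+ε}·mgf F ν u` at `u = 0`
(`F` bounded measurable): either BOTH measures vanish, or BOTH are non-zero. -/
theorem neZero_or_eq_zero_of_sandwich (hFm : Measurable F) (hF : ∀ ω, |F ω| ≤ B) {c ε : ℝ}
    (h0 : Real.exp (c - ε) * mgf F ν 0 ≤ mgf F' ν' 0 ∧ mgf F' ν' 0 ≤ Real.exp (c + ε) * mgf F ν 0) :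
    (ν = 0 ∧ ν' = 0) ∨ (NeZero ν ∧ NeZero ν') := by
  rcases eq_zero_or_neZero ν with hν | hν
  · refine Or.inl ⟨hν, ?_⟩
    have h := h0.2
    rw [hν, mgf_zero_measure, Pi.zero_apply, mul_zero, mgf_zero'] at h
    rw [← Measure.measure_univ_eq_zero, ← measureReal_eq_zero_iff]
    exact le_antisymm h measureReal_nonneg
  · refine Or.inr ⟨hν, ⟨fun h' => ?_⟩⟩
    have h := h0.1
    rw [h', mgf_zero_measure, Pi.zero_apply] at h
    exact absurd h (not_le.mpr (mul_pos (Real.exp_pos _) (T4GenFunBounds.mgf_pos_of_abs_le hFm.aemeasurable (ae_of_all _ hF) 0)))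

/-- **THE MGF SANDWICH (the shape of `NE7.Core` on one class) ⇒ CLOSE TILTED MEANS INSIDE THE WINDOW, LINEAR-LOG PRICE** [folklore].
`ν`, `ν′` finite (NO mass hypothesis: a massless class of one run is massless in the other, both tilted means are `0`), `F`, `F′`
measurable with `|F|, |F′| ≤ B`; if `e^{c−ε}·mgf F ν u ≤ mgf F′ ν′ u ≤ e^{c+ε}·mgf F ν u` for `|u| ≤ l₀` (`0 ≤ ε`), then for `|s| ≤ l₁ < l₀`:
`|tiltedMean F′ ν′ s − tiltedMean F ν s| ≤ 8e^{1+(l₀−l₁)B}·ε·(1 + log⁺(2ε)⁻¹)∕(l₀ − l₁)`. -/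
theorem abs_tiltedMean_sub_le_linlog_of_sandwich (hFm : Measurable F) (hF : ∀ ω, |F ω| ≤ B)
    (hFm' : Measurable F') (hF' : ∀ ω, |F' ω| ≤ B) {c ε l₀ l₁ : ℝ} (hl : l₁ < l₀) (hε0 : 0 ≤ ε)
    (h : ∀ u : ℝ, |u| ≤ l₀ →
      Real.exp (c - ε) * mgf F ν u ≤ mgf F' ν' u ∧ mgf F' ν' u ≤ Real.exp (c + ε) * mgf F ν u)
    {s : ℝ} (hs : |s| ≤ l₁) :
    |tiltedMean F' ν' s - tiltedMean F ν s| ≤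
      8 * Real.exp (1 + (l₀ - l₁) * B) * ε * (1 + Real.posLog (2 * ε)⁻¹) / (l₀ - l₁) := by
  have hl₀ : 0 ≤ l₀ := ((abs_nonneg s).trans hs).trans hl.le
  rcases neZero_or_eq_zero_of_sandwich (ν := ν) (ν' := ν') hFm hF (h 0 (by simpa using hl₀)) with ⟨hν, hν'⟩ | ⟨hν, hν'⟩
  · have hpl : 0 ≤ Real.posLog (2 * ε)⁻¹ := Real.posLog_nonneg
    have hd : 0 < l₀ - l₁ := sub_pos.mpr hl
    rw [hν, hν', tiltedMean_zero_measure, tiltedMean_zero_measure, sub_zero, abs_zero]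
    positivity
  · refine abs_tiltedMean_sub_le_linlog_of_cgf_close hFm hF hFm' hF' hl hε0 (c := c) (fun u hu => ?_) hs
    have hP : 0 < mgf F ν u := T4GenFunBounds.mgf_pos_of_abs_le hFm.aemeasurable (ae_of_all _ hF) u
    exact abs_log_sub_log_sub_le_of_sandwich hP (h u hu).1 (h u hu).2

/-- **THE MGF SANDWICH ⇒ CLOSE TILTED MEANS, price √** [folklore]: as above, with the bound `4ε∕(l₀ − l₁) + 2B·√ε` (`0 ≤ B` displayed for the
massless case). -/
theorem abs_tiltedMean_sub_le_sqrt_of_sandwich (hFm : Measurable F) (hF : ∀ ω, |F ω| ≤ B)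
    (hFm' : Measurable F') (hF' : ∀ ω, |F' ω| ≤ B) (hB : 0 ≤ B) {c ε l₀ l₁ : ℝ} (hl : l₁ < l₀) (hε0 : 0 ≤ ε)
    (h : ∀ u : ℝ, |u| ≤ l₀ →
      Real.exp (c - ε) * mgf F ν u ≤ mgf F' ν' u ∧ mgf F' ν' u ≤ Real.exp (c + ε) * mgf F ν u)
    {s : ℝ} (hs : |s| ≤ l₁) :
    |tiltedMean F' ν' s - tiltedMean F ν s| ≤ 4 * ε / (l₀ - l₁) + 2 * B * Real.sqrt ε := by
  have hl₀ : 0 ≤ l₀ := ((abs_nonneg s).trans hs).trans hl.le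
  rcases neZero_or_eq_zero_of_sandwich (ν := ν) (ν' := ν') hFm hF (h 0 (by simpa using hl₀)) with ⟨hν, hν'⟩ | ⟨hν, hν'⟩
  · have hd : 0 < l₀ - l₁ := sub_pos.mpr hl
    have hsq : 0 ≤ Real.sqrt ε := Real.sqrt_nonneg _
    rw [hν, hν', tiltedMean_zero_measure, tiltedMean_zero_measure, sub_zero, abs_zero]
    positivity
  · refine abs_tiltedMean_sub_le_sqrt_of_cgf_close hFm hF hFm' hF' hl (c := c) (fun u hu => ?_) hs
    have hP : 0 < mgf F ν u := T4GenFunBounds.mgf_pos_of_abs_le hFm.aemeasurable (ae_of_all _ hF) u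
    exact abs_log_sub_log_sub_le_of_sandwich hP (h u hu).1 (h u hu).2

/-- **THE `ε = 0` FACE: EXACT MATCHING MOD A CONSTANT ON A WINDOW ⇒ IDENTICAL TILTED MEANS INSIDE** [folklore].  If
`mgf F′ ν′ u = e^{c}·mgf F ν u` for all `|u| ≤ l₀`, then `tiltedMean F′ ν′ s = tiltedMean F ν s` for every `|s| < l₀` (the bound above at
`ε = 0` vanishes: `log⁺ 0⁻¹ = 0` in Mathlib's conventions). -/
theorem tiltedMean_eq_of_mgf_eq_mul (hFm : Measurable F) (hF : ∀ ω, |F ω| ≤ B) (hFm' : Measurable F') (hF' : ∀ ω, |F' ω| ≤ B)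
    {c l₀ : ℝ} (h : ∀ u : ℝ, |u| ≤ l₀ → mgf F' ν' u = Real.exp c * mgf F ν u) {s : ℝ} (hs : |s| < l₀) :
    tiltedMean F' ν' s = tiltedMean F ν s := by
  have key := abs_tiltedMean_sub_le_linlog_of_sandwich (ν := ν) (ν' := ν') hFm hF hFm' hF' hs le_rfl (c := c) (ε := 0)
    (fun u hu => by rw [sub_zero, add_zero, h u hu]; exact ⟨le_rfl, le_rfl⟩) le_rfl
  have e : 8 * Real.exp (1 + (l₀ - |s|) * B) * 0 * (1 + Real.posLog (2 * (0 : ℝ))⁻¹) / (l₀ - |s|) = 0 := by ring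
  rw [e] at key
  exact sub_eq_zero.mp (abs_nonpos_iff.mp key)

end OneClass

/-! ## §3 At N19's leaf: `NE7.Core` for MGF-form cores ⇒ the vacuum core (V) and N14's binder (I) on every inner window -/

section Leaf

variable {ι : Type*} [DecidableEq ι] {Ω Ω' : ℕ → Type*} [∀ K, MeasurableSpace (Ω K)] [∀ K, MeasurableSpace (Ω' K)]
  {B l₀ l₁ vol : ℝ} {T : ℕ → Finset ι} {Bad : ℕ → ℝ → Finset ι} {F : ∀ K, Ω K → ℝ} {ν : ∀ K, ι → Measure (Ω K)}
  {F' : ∀ K, Ω' K → ℝ} {ν' : ∀ K, ι → Measure (Ω' K)} {P Q : ℕ → ℝ → ι → ℝ} {δ : ℕ → ℝ}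

omit [∀ K, MeasurableSpace (Ω K)] [∀ K, MeasurableSpace (Ω' K)] in
/-- **(V) FROM `Core`: THE VACUUM (`t = 0`) FACE** [bookkeeping].  `NE7.Core l₀ …` on the window, with t-uniform goodness of the classes
(`Bad K u ⊆ Bad K t` for `|t| ≤ l₁ ≤ l₀`, `|u| ≤ l₀`), gives the core of the `t`-idle vacuum families `(K, t, τ) ↦ P K 0 τ`, `Q K 0 τ` with the
SAME constants and remainder on the window `l₁` — the `h0` of the join `core_of_coreZero_mgfForm` ∕ `DressedMGFForm.core_of_mgfForm`. -/
theorem coreZero_of_core (h : NE7.Core l₀ vol T Bad P Q δ) (hl : l₁ ≤ l₀)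
    (hBad : ∀ K (t u : ℝ), |t| ≤ l₁ → |u| ≤ l₀ → Bad K u ⊆ Bad K t) :
    NE7.Core l₁ vol T Bad (fun K _ τ => P K 0 τ) (fun K _ τ => Q K 0 τ) δ := by
  intro K
  obtain ⟨c, hc⟩ := h K
  refine ⟨c, fun t ht τ hτ => ?_⟩
  have h0 : |(0 : ℝ)| ≤ l₀ := by simpa using (abs_nonneg t).trans (ht.trans hl)
  have hτ0 : τ ∈ T K \ Bad K 0 := by
    rw [Finset.mem_sdiff] at hτ ⊢
    exact ⟨hτ.1, fun hb => hτ.2 (hBad K t 0 ht h0 hb)⟩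
  exact hc 0 h0 τ hτ0

/-- ★ **(I) FROM `Core`: `NE7.Core` FOR MGF-FORM CORES ⇒ `TiltedMeanMatching` ON EVERY INNER WINDOW, LINEAR-LOG PRICE** — THE CONVERSE OF
THE JOIN.  Shell-free cores `P` (run A) and `Q` (run B) in MGF form (`DressedMGFForm.MGFForm`, bound `B`), the dressed core sandwich
`NE7.Core l₀ vol T Bad P Q δ` (`0 ≤ vol`, `0 ≤ δ`), t-uniform goodness of the classes on the window; then for every `l₁ < l₀`
`TiltedMeanMatching l₁ T Bad F ν F′ ν′ η` with `η K = 8e^{1+(l₀−l₁)B}·volδ_K·(1 + log⁺(2volδ_K)⁻¹)∕(l₀ − l₁)`.  Compare the join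
(`core_of_mgfForm`: (V) width `w` + (I) `η` ⇒ `Core` width `w + l₀η`): up to the window shrink and one logarithm the two currencies agree.
[folklore] -/
theorem tiltedMeanMatching_of_core (hP : MGFForm B T F ν P) (hQ : MGFForm B T F' ν' Q) (h : NE7.Core l₀ vol T Bad P Q δ)
    (hl : l₁ < l₀) (hvol : 0 ≤ vol) (hδ : ∀ K, 0 ≤ δ K)
    (hBad : ∀ K (t u : ℝ), |t| ≤ l₁ → |u| ≤ l₀ → Bad K u ⊆ Bad K t) :
    TiltedMeanMatching l₁ T Bad F ν F' ν' fun K =>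
      8 * Real.exp (1 + (l₀ - l₁) * B) * (vol * δ K) * (1 + Real.posLog (2 * (vol * δ K))⁻¹) / (l₀ - l₁) := by
  intro K t ht τ hτ s hs
  obtain ⟨c, hc⟩ := h K
  have hτT : τ ∈ T K := (Finset.mem_sdiff.mp hτ).1
  haveI := hP.finite K τ hτT
  haveI := hQ.finite K τ hτT
  refine abs_tiltedMean_sub_le_linlog_of_sandwich (hP.meas K) (hP.bound K) (hQ.meas K) (hQ.bound K) hl
    (mul_nonneg hvol (hδ K)) (c := c) (fun u hu => ?_) hs
  have hτu : τ ∈ T K \ Bad K u := by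
    rw [Finset.mem_sdiff] at hτ ⊢
    exact ⟨hτ.1, fun hb => hτ.2 (hBad K t u ht hu hb)⟩
  have key := hc u hu τ hτu
  rwa [hP.repr K u τ hτT, hQ.repr K u τ hτT] at key

/-- **(I) FROM `Core`, THE REAL-VARIABLE ROAD (price √)**: same hypotheses ⇒ `TiltedMeanMatching l₁ T Bad F ν F′ ν′ η` with
`η K = 4volδ_K∕(l₀ − l₁) + 2B·√(volδ_K)` (Landau; no `e^{(l₀−l₁)B}`, no logarithm; summability then needs `Σ √δ_K < ∞`). [folklore] -/
theorem tiltedMeanMatching_of_core_sqrt (hP : MGFForm B T F ν P) (hQ : MGFForm B T F' ν' Q) (h : NE7.Core l₀ vol T Bad P Q δ)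
    (hl : l₁ < l₀) (hvol : 0 ≤ vol) (hδ : ∀ K, 0 ≤ δ K)
    (hBad : ∀ K (t u : ℝ), |t| ≤ l₁ → |u| ≤ l₀ → Bad K u ⊆ Bad K t) :
    TiltedMeanMatching l₁ T Bad F ν F' ν' fun K => 4 * (vol * δ K) / (l₀ - l₁) + 2 * B * Real.sqrt (vol * δ K) := by
  intro K t ht τ hτ s hs
  obtain ⟨c, hc⟩ := h K
  have hτT : τ ∈ T K := (Finset.mem_sdiff.mp hτ).1
  haveI := hP.finite K τ hτT
  haveI := hQ.finite K τ hτT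
  refine abs_tiltedMean_sub_le_sqrt_of_sandwich (hP.meas K) (hP.bound K) (hQ.meas K) (hQ.bound K) hP.nonneg hl
    (mul_nonneg hvol (hδ K)) (c := c) (fun u hu => ?_) hs
  have hτu : τ ∈ T K \ Bad K u := by
    rw [Finset.mem_sdiff] at hτ ⊢
    exact ⟨hτ.1, fun hb => hτ.2 (hBad K t u ht hu hb)⟩
  have key := hc u hu τ hτu
  rwa [hP.repr K u τ hτT, hQ.repr K u τ hτT] at key

/-- `log⁺ (2x)⁻¹ ≤ log⁺ x⁻¹` for `x ≥ 0` (monotonicity of `log⁺`; the junk value `0⁻¹ = 0` matched). [folklore] -/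
theorem posLog_inv_two_mul_le {x : ℝ} (hx : 0 ≤ x) : Real.posLog (2 * x)⁻¹ ≤ Real.posLog x⁻¹ := by
  rcases hx.eq_or_lt with h0 | hpos; · simp [← h0]
  exact Real.posLog_le_posLog (inv_nonneg.mpr (by positivity)) (inv_anti₀ hpos (by linarith))

/-- **SUMMABLE BINDER FROM A LIN-LOG-SUMMABLE CORE REMAINDER**: under the hypotheses of `tiltedMeanMatching_of_core`, if
`Σ_K volδ_K·(1 + log⁺(volδ_K)⁻¹) < ∞` then the binder's `η` may be taken SUMMABLE — the `Summable η` clause of the join's ∃δ-form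
(`…N19VacuumMGFRoad.coreEdge_of_coreZero_mgfForm`, `DressedMGFForm.hybridNE7_of_mgfForm`).  The lin-log summability is WEAKER than `Σ √δ_K < ∞`
and holds for geometric remainders (`…TwoConstantsAtScheme` §4). [folklore] -/
theorem tiltedMeanMatching_summable_of_core (hP : MGFForm B T F ν P) (hQ : MGFForm B T F' ν' Q) (h : NE7.Core l₀ vol T Bad P Q δ)
    (hl : l₁ < l₀) (hvol : 0 ≤ vol) (hδ : ∀ K, 0 ≤ δ K)
    (hBad : ∀ K (t u : ℝ), |t| ≤ l₁ → |u| ≤ l₀ → Bad K u ⊆ Bad K t)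
    (hsum : Summable fun K => vol * δ K * (1 + Real.posLog (vol * δ K)⁻¹)) :
    ∃ η : ℕ → ℝ, TiltedMeanMatching l₁ T Bad F ν F' ν' η ∧ Summable η := by
  refine ⟨_, tiltedMeanMatching_of_core hP hQ h hl hvol hδ hBad, ?_⟩
  have hd : 0 < l₀ - l₁ := sub_pos.mpr hl
  refine Summable.of_nonneg_of_le (fun K => ?_) (fun K => ?_) (hsum.mul_left (8 * Real.exp (1 + (l₀ - l₁) * B) / (l₀ - l₁)))
  · have hδK : 0 ≤ δ K := hδ K
    have hpl : 0 ≤ Real.posLog (2 * (vol * δ K))⁻¹ := Real.posLog_nonneg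
    positivity
  · have hδK : 0 ≤ δ K := hδ K
    have hx : 0 ≤ vol * δ K := mul_nonneg hvol hδK
    have e : 8 * Real.exp (1 + (l₀ - l₁) * B) / (l₀ - l₁) * (vol * δ K * (1 + Real.posLog (vol * δ K)⁻¹))
        = 8 * Real.exp (1 + (l₀ - l₁) * B) * (vol * δ K) * (1 + Real.posLog (vol * δ K)⁻¹) / (l₀ - l₁) := by ring
    rw [e]
    refine div_le_div_of_nonneg_right (mul_le_mul_of_nonneg_left ?_ (by positivity)) hd.le
    exact add_le_add_right (posLog_inv_two_mul_le hx) 1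

/-- **GEOMETRIC CORE REMAINDERS GIVE A SUMMABLE BINDER**: `0 ≤ δ_K ≤ C·θ^K` (`0 ≤ θ < 1`) ⇒ `∃ η, TiltedMeanMatching l₁ … η ∧ Summable η`
(`summable_linlog_of_le_geometric` BY NAME). [folklore] -/
theorem tiltedMeanMatching_summable_of_core_geometric (hP : MGFForm B T F ν P) (hQ : MGFForm B T F' ν' Q)
    (h : NE7.Core l₀ vol T Bad P Q δ) (hl : l₁ < l₀) (hvol : 0 ≤ vol) (hδ : ∀ K, 0 ≤ δ K)
    (hBad : ∀ K (t u : ℝ), |t| ≤ l₁ → |u| ≤ l₀ → Bad K u ⊆ Bad K t)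
    {C θ : ℝ} (hθ : 0 ≤ θ) (hθ1 : θ < 1) (hle : ∀ K, δ K ≤ C * θ ^ K) :
    ∃ η : ℕ → ℝ, TiltedMeanMatching l₁ T Bad F ν F' ν' η ∧ Summable η :=
  tiltedMeanMatching_summable_of_core hP hQ h hl hvol hδ hBad
    (summable_linlog_of_le_geometric (δ := fun K => vol * δ K) (C := vol * C) (fun K => mul_nonneg hvol (hδ K)) hθ hθ1
      fun K => by simpa only [mul_assoc] using mul_le_mul_of_nonneg_left (hle K) hvol)

/-- ★★ **THE CONVERSE OF THE JOIN'S ∃δ-FORM: ITS EXACT HYPOTHESIS LIST RECOVERED FROM ITS CONCLUSION, ON THE INNER WINDOW.**  The join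
(`…N19VacuumMGFRoad.coreEdge_of_coreZero_mgfForm`, lens ROW VL-1′) reads: MGF forms + vacuum core with summable `δ⁰` + `TiltedMeanMatching` with
summable `η` ⇒ `∃ δ, NE7.Core l₀ vol T Bad P Q δ ∧ Summable δ`.  Conversely: MGF forms + `NE7.Core l₀ vol T Bad P Q δ` with `0 ≤ δ` lin-log
summable (`0 < vol`, t-uniform goodness) ⇒ on every inner window `l₁ < l₀` a vacuum core with SUMMABLE remainder AND a `TiltedMeanMatching` with
SUMMABLE `η`.  For ONE bounded observable the displayed pair (V)+(I) of road (ii) is thus NECESSARY as well as sufficient for NE7-proper, up to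
(window shrink, one logarithm in the summability class).  [folklore] -/
theorem coreZero_tiltedMeanMatching_of_coreEdge (hP : MGFForm B T F ν P) (hQ : MGFForm B T F' ν' Q) (hl : l₁ < l₀)
    (hvol : 0 < vol) (hBad : ∀ K (t u : ℝ), |t| ≤ l₁ → |u| ≤ l₀ → Bad K u ⊆ Bad K t)
    (h : ∃ δ : ℕ → ℝ, (∀ K, 0 ≤ δ K) ∧ NE7.Core l₀ vol T Bad P Q δ ∧
      Summable fun K => vol * δ K * (1 + Real.posLog (vol * δ K)⁻¹)) :
    ∃ δ₀ η : ℕ → ℝ, NE7.Core l₁ vol T Bad (fun K _ τ => P K 0 τ) (fun K _ τ => Q K 0 τ) δ₀ ∧ Summable δ₀ ∧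
      TiltedMeanMatching l₁ T Bad F ν F' ν' η ∧ Summable η := by
  obtain ⟨δ, hδ, hcore, hsum⟩ := h
  obtain ⟨η, hη, hηs⟩ := tiltedMeanMatching_summable_of_core hP hQ hcore hl hvol.le hδ hBad hsum
  refine ⟨δ, η, coreZero_of_core hcore hl.le hBad, ?_, hη, hηs⟩
  have h1 : Summable fun K => vol * δ K := Summable.of_nonneg_of_le (fun K => mul_nonneg hvol.le (hδ K))
    (fun K => le_mul_of_one_le_right (mul_nonneg hvol.le (hδ K)) (le_add_of_nonneg_right Real.posLog_nonneg)) hsum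
  simpa only [inv_mul_cancel_left₀ hvol.ne'] using h1.mul_left vol⁻¹

/-- **ANY H1L PRODUCER OF NE7-PROPER PRODUCES N14's BINDER**: the H1L face `NE7.PathLeaf l₀ vol T Bad P Q δ` (a positive `C¹` path per good term
with a common drift; `NE7.core_of_pathLeaf` BY NAME) for MGF-form cores gives `TiltedMeanMatching` on every inner window at the lin-log price.
[folklore] -/
theorem tiltedMeanMatching_of_pathLeaf (hP : MGFForm B T F ν P) (hQ : MGFForm B T F' ν' Q) (h : NE7.PathLeaf l₀ vol T Bad P Q δ)
    (hl : l₁ < l₀) (hvol : 0 ≤ vol) (hδ : ∀ K, 0 ≤ δ K)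
    (hBad : ∀ K (t u : ℝ), |t| ≤ l₁ → |u| ≤ l₀ → Bad K u ⊆ Bad K t) :
    TiltedMeanMatching l₁ T Bad F ν F' ν' fun K =>
      8 * Real.exp (1 + (l₀ - l₁) * B) * (vol * δ K) * (1 + Real.posLog (2 * (vol * δ K))⁻¹) / (l₀ - l₁) :=
  tiltedMeanMatching_of_core hP hQ (NE7.core_of_pathLeaf h) hl hvol hδ hBad

/-- **AT THE NODE's SHAPE `HybridNE7`**: its `core` field on the shell-free cores `A − shA`, `B − shB` (`NE7.core_of_hybridNE7` BY NAME), in MGF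
form, gives `TiltedMeanMatching` on every inner window at the lin-log price. [folklore] -/
theorem tiltedMeanMatching_of_hybridNE7 {A Bf shA shB : ℕ → ℝ → ι → ℝ} {W Wsh : ℕ → ℝ}
    (hP : MGFForm B T F ν fun K t τ => A K t τ - shA K t τ) (hQ : MGFForm B T F' ν' fun K t τ => Bf K t τ - shB K t τ)
    (h : T4MatchingAssembly.HybridNE7 l₀ vol T A Bf Bad W shA shB Wsh δ) (hl : l₁ < l₀) (hvol : 0 ≤ vol) (hδ : ∀ K, 0 ≤ δ K)
    (hBad : ∀ K (t u : ℝ), |t| ≤ l₁ → |u| ≤ l₀ → Bad K u ⊆ Bad K t) :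
    TiltedMeanMatching l₁ T Bad F ν F' ν' fun K =>
      8 * Real.exp (1 + (l₀ - l₁) * B) * (vol * δ K) * (1 + Real.posLog (2 * (vol * δ K))⁻¹) / (l₀ - l₁) :=
  tiltedMeanMatching_of_core hP hQ (NE7.core_of_hybridNE7 h) hl hvol hδ hBad

end Leaf

end Summit.QuantumFields.YangMills.BalabanUVNodes.N19MGFJoinConverse
end
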